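import Literature.NumberTheory.Automorphic.OrbitalMeasureFamilyRegular
import Literature.NumberTheory.Automorphic.SmoothIndTransport
import Mathlib.Topology.Algebra.Group.OpenMapping
import HarnessLib

/-!
# A direct factor of a unimodular group is unimodular
(Folland, *A Course in Abstract Harmonic Analysis* (1995), §2.4 Prop. 2.27; Bourbaki, *Intégration* VII §2 no. 7: the modular function of a
product; Deitmar–Echterhoff (2014), §1.5)

Topic `MeasureTheory/Group`; namespace `Literature.MeasureTheory.Group`.  THEOREMS ONLY (no def, no instance, no named fact, no `sorry`), over
Mathlib's `modularCharacterFun`, the tree's ★ `isMulRightInvariant_of_modularCharacterFun_eq_one` ∕ `modularCharacterFun_eq_one_of_map_mul_right_apply_eq`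
∕ `MeasureTheory.Measure.modularCharacter_continuousMulEquiv`, and Mathlib's open mapping theorem `MonoidHom.isOpenMap_of_sigmaCompact`.

The converse of ★ `modularCharacterFun_prod_eq_one` (two unimodular groups have a unimodular product): if `A × B` is unimodular then so are
`A` and `B` (`Δ_{A×B}(a, 1) = Δ_A(a)`: the product Haar measure is right invariant, test on a box); transported along `≃ₜ*`; and the form in
which it is met on adelic groups — an INTERNAL direct factor: a continuous injective homomorphism `ι : N →* G` and a closed subgroup `C ≤ G`
commuting with `ι(N)` such that `(n, c) ↦ ι(n) c` is a bijection `N × C → G`; then `N × C ≃ₜ* G` (open mapping theorem: `N × C` is σ-compact, `G`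
locally compact Hausdorff) and `Δ_G ≡ 1 ⇒ Δ_N ≡ 1`.  Use: `U(J)(F_v) ↪ U(J)(𝔸_F)` with complement `{g | g_v = 1}` — local unimodularity from
adelic unimodularity (sequel `LocalUnitaryGroupUnimodularOfAdelic`).

* §1 `modularCharacterFun_eq_one_left_of_prod`, `modularCharacterFun_eq_one_right_of_prod`.
* §2 `modularCharacterFun_eq_one_of_continuousMulEquiv` (`G ≃ₜ* G′`, `Δ_{G′} ≡ 1 ⇒ Δ_G ≡ 1`), `modularCharacterFun_eq_one_left_of_continuousMulEquiv_prod`.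
* §3 **`modularCharacterFun_eq_one_of_isComplement`** — the internal-direct-factor form.

## References
* G. B. Folland, *A Course in Abstract Harmonic Analysis* (1995), §2.4 Prop. 2.27 [Folland1995].
* A. Deitmar, S. Echterhoff, *Principles of Harmonic Analysis*, 2nd ed. (2014), §1.5 [DeitmarEchterhoff2014].
-/

noncomputable section

open MeasureTheory Measure Topology
open Literature.NumberTheory.Automorphic
open scoped NNReal ENNReal

namespace Literature.MeasureTheory.Group

/-! ## §1 The factors of a unimodular product are unimodular -/

section Prod

variable {A B : Type*} [Group A] [TopologicalSpace A] [IsTopologicalGroup A] [LocallyCompactSpace A] [SecondCountableTopology A]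
  [Group B] [TopologicalSpace B] [IsTopologicalGroup B] [LocallyCompactSpace B] [SecondCountableTopology B]

/-- **The left factor of a unimodular product is unimodular**: `Δ_{A × B} ≡ 1 ⇒ Δ_A ≡ 1` (the product of two Haar measures is then right
invariant; test it on a box `K_A × K_B` against right translation by `(a, 1)`). [cite: Folland1995, §2.4 Prop. 2.27] -/
theorem modularCharacterFun_eq_one_left_of_prod (h : ∀ g : A × B, modularCharacterFun g = 1) (a : A) : modularCharacterFun a = 1 := by
  borelize A B
  set μA : Measure A := haar
  set μB : Measure B := haar
  haveI : (μA.prod μB).IsMulRightInvariant := isMulRightInvariant_of_modularCharacterFun_eq_one h _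
  obtain ⟨KA⟩ : Nonempty (TopologicalSpace.PositiveCompacts A) := inferInstance
  obtain ⟨KB⟩ : Nonempty (TopologicalSpace.PositiveCompacts B) := inferInstance
  have hA0 : μA KA ≠ 0 := (measure_pos_of_nonempty_interior μA KA.interior_nonempty).ne'
  have hAt : μA KA ≠ ∞ := KA.isCompact.measure_lt_top.ne
  have hB0 : μB KB ≠ 0 := (measure_pos_of_nonempty_interior μB KB.interior_nonempty).ne'
  have hBt : μB KB ≠ ∞ := KB.isCompact.measure_lt_top.ne
  -- `map (· * (a,1)) (μA × μB) = (map (· * a) μA) × μB`, and it equals `μA × μB` by right invariance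
  have hmap : (Measure.map (· * a) μA).prod μB = μA.prod μB := by
    have h1 : (Measure.map (· * a) μA).prod (Measure.map id μB) = Measure.map (· * ((a, 1) : A × B)) (μA.prod μB) := by
      rw [Measure.map_prod_map μA μB (measurable_mul_const a) measurable_id]
      congr 1
      funext p
      simp [Prod.map, Prod.mul_def]
    rw [Measure.map_id] at h1
    rw [h1, map_mul_right_eq_self]
  have hbox : Measure.map (· * a) μA KA * μB KB = μA KA * μB KB := by
    rw [← Measure.prod_prod, ← Measure.prod_prod, hmap]
  have hKA : Measure.map (· * a) μA KA = μA KA := (ENNReal.mul_left_inj hB0 hBt).1 hbox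
  exact modularCharacterFun_eq_one_of_map_mul_right_apply_eq μA hA0 hAt hKA

/-- **The right factor of a unimodular product is unimodular**: `Δ_{A × B} ≡ 1 ⇒ Δ_B ≡ 1`. [cite: Folland1995, §2.4 Prop. 2.27] -/
theorem modularCharacterFun_eq_one_right_of_prod (h : ∀ g : A × B, modularCharacterFun g = 1) (b : B) : modularCharacterFun b = 1 := by
  borelize A B
  set μA : Measure A := haar
  set μB : Measure B := haar
  haveI : (μA.prod μB).IsMulRightInvariant := isMulRightInvariant_of_modularCharacterFun_eq_one h _
  obtain ⟨KA⟩ : Nonempty (TopologicalSpace.PositiveCompacts A) := inferInstance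
  obtain ⟨KB⟩ : Nonempty (TopologicalSpace.PositiveCompacts B) := inferInstance
  have hA0 : μA KA ≠ 0 := (measure_pos_of_nonempty_interior μA KA.interior_nonempty).ne'
  have hAt : μA KA ≠ ∞ := KA.isCompact.measure_lt_top.ne
  have hB0 : μB KB ≠ 0 := (measure_pos_of_nonempty_interior μB KB.interior_nonempty).ne'
  have hBt : μB KB ≠ ∞ := KB.isCompact.measure_lt_top.ne
  have hmap : μA.prod (Measure.map (· * b) μB) = μA.prod μB := by
    have h1 : (Measure.map id μA).prod (Measure.map (· * b) μB) = Measure.map (· * ((1, b) : A × B)) (μA.prod μB) := by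
      rw [Measure.map_prod_map μA μB measurable_id (measurable_mul_const b)]
      congr 1
      funext p
      simp [Prod.map, Prod.mul_def]
    rw [Measure.map_id] at h1
    rw [h1, map_mul_right_eq_self]
  have hbox : μA KA * Measure.map (· * b) μB KB = μA KA * μB KB := by
    rw [← Measure.prod_prod, ← Measure.prod_prod, hmap]
  have hKB : Measure.map (· * b) μB KB = μB KB := (ENNReal.mul_right_inj hA0 hAt).1 hbox
  exact modularCharacterFun_eq_one_of_map_mul_right_apply_eq μB hB0 hBt hKB

end Prod

/-! ## §2 Along an isomorphism of topological groups -/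

section Equiv

variable {G G' : Type*} [Group G] [TopologicalSpace G] [IsTopologicalGroup G] [LocallyCompactSpace G]
  [Group G'] [TopologicalSpace G'] [IsTopologicalGroup G'] [LocallyCompactSpace G']

/-- `G ≃ₜ* G′` and `Δ_{G′} ≡ 1` give `Δ_G ≡ 1` (★ `MeasureTheory.Measure.modularCharacter_continuousMulEquiv`). [cite: Folland1995, §2.4 Prop. 2.27] -/
theorem modularCharacterFun_eq_one_of_continuousMulEquiv (e : G ≃ₜ* G') (h : ∀ g' : G', modularCharacterFun g' = 1) (g : G) :
    modularCharacterFun g = 1 := by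
  have h1 : modularCharacter (e g) = modularCharacter g := MeasureTheory.Measure.modularCharacter_continuousMulEquiv e g
  change modularCharacterFun (e g) = modularCharacterFun g at h1
  rw [← h1, h]

variable {A B : Type*} [Group A] [TopologicalSpace A] [IsTopologicalGroup A] [LocallyCompactSpace A] [SecondCountableTopology A]
  [Group B] [TopologicalSpace B] [IsTopologicalGroup B] [LocallyCompactSpace B] [SecondCountableTopology B]

/-- **A direct factor of a unimodular group is unimodular**: `G ≃ₜ* A × B` and `Δ_G ≡ 1` give `Δ_A ≡ 1`. [cite: Folland1995, §2.4 Prop. 2.27] -/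
theorem modularCharacterFun_eq_one_left_of_continuousMulEquiv_prod (e : G ≃ₜ* A × B) (h : ∀ g : G, modularCharacterFun g = 1) (a : A) :
    modularCharacterFun a = 1 :=
  modularCharacterFun_eq_one_left_of_prod (modularCharacterFun_eq_one_of_continuousMulEquiv e.symm h) a

end Equiv

/-! ## §3 Internal direct factors: a commuting closed complement -/

section Complement

variable {N G : Type*} [Group N] [TopologicalSpace N] [IsTopologicalGroup N] [LocallyCompactSpace N] [SecondCountableTopology N]
  [Group G] [TopologicalSpace G] [IsTopologicalGroup G] [LocallyCompactSpace G] [SecondCountableTopology G] [T2Space G]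

/-- **An internal direct factor of a unimodular group is unimodular.**  `ι : N →* G` continuous injective, `C ≤ G` a closed subgroup commuting
elementwise with `ι(N)`, and `(n, c) ↦ ι(n) · c` a BIJECTION `N × C → G`: then it is a continuous bijective homomorphism from the σ-compact
group `N × C` onto the locally compact Hausdorff `G`, hence open (Mathlib `MonoidHom.isOpenMap_of_sigmaCompact`) — `N × C ≃ₜ* G` — and
`Δ_G ≡ 1` forces `Δ_N ≡ 1` (§1–§2). [cite: Folland1995, §2.4 Prop. 2.27] [cite: DeitmarEchterhoff2014, §1.5] -/
theorem modularCharacterFun_eq_one_of_isComplement (ι : N →* G) (hι : Continuous ι) (C : Subgroup G) (hC : IsClosed (C : Set G))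
    (hcomm : ∀ (n : N) (c : G), c ∈ C → ι n * c = c * ι n) (hbij : Function.Bijective fun p : N × C => ι p.1 * (p.2 : G))
    (hG : ∀ g : G, modularCharacterFun g = 1) (n : N) : modularCharacterFun n = 1 := by
  haveI : LocallyCompactSpace C := hC.isClosedEmbedding_subtypeVal.locallyCompactSpace
  -- the multiplication homomorphism `N × C →* G`
  let f : N × C →* G :=
    { toFun := fun p => ι p.1 * (p.2 : G)
      map_one' := by simp
      map_mul' := fun p q => by
        change ι (p.1 * q.1) * ((p.2 : G) * (q.2 : G)) = ι p.1 * (p.2 : G) * (ι q.1 * (q.2 : G))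
        rw [map_mul, mul_assoc, mul_assoc, ← mul_assoc (ι q.1), hcomm q.1 (p.2 : G) p.2.2, mul_assoc] }
  have hfc : Continuous f := (hι.comp continuous_fst).mul (continuous_subtype_val.comp continuous_snd)
  haveI : SecondCountableTopology C := TopologicalSpace.Subtype.secondCountableTopology _
  haveI : SigmaCompactSpace N := sigmaCompactSpace_of_locallyCompact_secondCountable
  haveI : SigmaCompactSpace C := sigmaCompactSpace_of_locallyCompact_secondCountable
  have hfo : IsOpenMap f := MonoidHom.isOpenMap_of_sigmaCompact f hbij.2 hfc
  let e : N × C ≃ₜ* G :=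
    { (Equiv.ofBijective f hbij).toHomeomorphOfContinuousOpen hfc hfo with
      map_mul' := f.map_mul }
  exact modularCharacterFun_eq_one_left_of_continuousMulEquiv_prod e.symm hG n

end Complement

end Literature.MeasureTheory.Group
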